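import Mathlib

/-!
# R27 «𝔾ₘ-NOSES THROUGH THE BLOB₂ LETTERS» — kernel companion (chart bookkeeping of the S-R26 walk)

OURS · L1 W4.5b · IDEATOR 1 (res-L1-w45b-idea-1 gen 36) · crux EL♮(3) = stmt-ResolutionOfSingularities-20148 · counted 0 ·
EL♮(3) is NOT proved here or anywhere in this file · AI-written, weaker than expert review · nothing below is attributed to [Hironaka2017].

WHAT THIS FILE CERTIFIES (kernel, `ring` only): the ALGEBRA of every chart of the blob₂ walk of the R26 specimen
`S-R26 : F = z⁴w² − y⁵w + xy³zw − 2x²yz²w + 2x⁴y² − x⁵z = A² + BC` (`A = z²w − x²y`, `B = x⁴ − y³w`, `C = y² − xz`; weights `(3,4,5,0)`,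
double along `Z = cl{[t³:t⁴:t⁵:1]}`): for each letter of the word
  `(pt)@P₀ · FREE round @Z^st · round @D (section of E_Z) · round @D′ (residual section ⊂ E_D) · FIBRE PAIR @Λ = E_D′ ∩ St²E_Z · (pt-reg)@q₂ · (pt-reg)@O_B`
the identity `parent(chart substitution) = (exceptional coordinate)^k · child` (so the printed strict transforms ARE the strict transforms, with the
printed exceptional multiplicities), the coordinate shifts placing each centre on coordinate axes, the 𝔾ₘ-equivariance (weighted homogeneity) of every
polar germ, the trace factorisations that identify the sections `D±`, `D′` and the fibre `Λ`, the completed-square normal forms (`Ẽ₈`: `u² + h(C,s²)`,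
`Ẽ₇`: `v² − q₄`), and membership of the R2-stage germ in `(u,y)²` (multiplicity ≥ 2 along `Λ`).
WHAT IT DOES NOT CERTIFY (kit job j328317, Sage/Singular over ℚ + GF(p) spot checks, table in `R27-GM-NOSES-BLOB-WALK.md` §7): the singular LOCI
(that the listed points/lines are ALL of `Sing`), smoothness of the two cubic cones, emptiness of `Sing` after R3 and after the final point steps,
`rad Sing(F) = I_Z`.  Self-intersections (`D±² = 4`, `D′² = 2`) are computed by 𝔾ₘ-localisation in the memo §3 (inputs = the weights recorded here).
-/

set_option linter.style.longLine false
set_option maxRecDepth 2000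
set_option linter.unusedVariables false
set_option linter.dupNamespace false

namespace Summit.ResolutionOfSingularities.ResolutionOfSingularities.Cruxes.EquisingularLiftNatThree.GmNosesBlobR27

/-! §0 The specimen `S-R26` (R26 family A345/c₁). -/

/-- `S-R26`. -/
def F (x y z w : ℚ) : ℚ := z^4*w^2 - y^5*w + x*y^3*z*w - 2*x^2*y*z^2*w + 2*x^4*y^2 - x^5*z
/-- `A = z²w − x²y`. -/
def A (x y z w : ℚ) : ℚ := z^2*w - x^2*y
/-- `B = x⁴ − y³w`. -/
def B (x y z w : ℚ) : ℚ := x^4 - y^3*w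
/-- `C = y² − xz`. -/
def C (x y z w : ℚ) : ℚ := y^2 - x*z

/-- the two-term certificate (crit-2 g11): `F = A² + B·C`, so `F ∈ I_Z²` for `Z = V(A,B,C) ⊇ cl{[t³:t⁴:t⁵:1]}`. -/
theorem two_term (x y z w : ℚ) : F x y z w = A x y z w ^ 2 + B x y z w * C x y z w := by
  unfold F A B C; ring

/-- 𝔾ₘ-invariance: `F(t³x, t⁴y, t⁵z, w) = t²⁰ F(x,y,z,w)`. -/
theorem F_weights (t x y z w : ℚ) : F (t^3*x) (t^4*y) (t^5*z) w = t^20 * F x y z w := by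
  unfold F; ring

/-- `Z = cl{[t³:t⁴:t⁵:1]}` lies on `A = B = C = 0`. -/
theorem Z_on_ABC (t : ℚ) : A (t^3) (t^4) (t^5) 1 = 0 ∧ B (t^3) (t^4) (t^5) 1 = 0 ∧ C (t^3) (t^4) (t^5) 1 = 0 := by
  unfold A B C; refine ⟨by ring, by ring, by ring⟩

/-- section matching across the poles (memo §2.4): on `S`, `X/V = −B/(xwC)` and `−BC = A²`; recorded as the polynomial identity behind it. -/
theorem match_identity (x y z w : ℚ) : -(B x y z w * C x y z w) - A x y z w ^ 2 = -(F x y z w) := by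
  unfold F A B C; ring


/-! §1 SOURCE POLE `P₀ = [0:0:0:1]` (chart `w = 1`, coordinate weights `(3,4,5)`). -/

/-- `fsrc(x,y,z)` — `F(x,y,z,1)`; `P₀` = origin, multiplicity 4; `Z = (t³,t⁴,t⁵)`. -/
def fsrc (p q r : ℚ) : ℚ := r^4 - q^5 + p*q^3*r + (-2 : ℚ)*p^2*q*r^2 + 2*p^4*q^2 - p^5*r

theorem fsrc_eq_F (p q r : ℚ) : fsrc p q r = F p q r 1 := by
  unfold fsrc F; ring

/-- weighted homogeneity, weights `(3, 4, 5)`, degree `20`. -/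
theorem fsrc_weights (t p q r : ℚ) : fsrc (t^3*p) (t^4*q) (t^5*r) = t^20 * fsrc p q r := by
  unfold fsrc; ring

/-- `St1(x,y₁,z₁)` — (pt) at `P₀`, chart `x` (`y = y₁x, z = z₁x`): coordinates `(x,y₁,z₁)`, weights `(3,1,2)`; `Z^st = (y₁³, y₁, y₁²)` regular; `z₀` = origin, multiplicity 3 (exceptional power 4). -/
def St1 (p q r : ℚ) : ℚ := -p^2*r + r^4 + (-2 : ℚ)*p*q*r^2 + 2*p^2*q^2 + p*q^3*r - p*q^5

theorem St1_chart (p q r : ℚ) : fsrc p (q*p) (r*p) = p^4 * St1 p q r := by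
  unfold fsrc St1; ring

/-- weighted homogeneity, weights `(3, 1, 2)`, degree `8`. -/
theorem St1_weights (t p q r : ℚ) : St1 (t^3*p) (t*q) (t^2*r) = t^8 * St1 p q r := by
  unfold St1; ring

/-- `St1y(x₂,y,z₂)` — (pt) at `P₀`, chart `y`: no singular point on the new plane in this chart (kit) (exceptional power 4). -/
def St1y (p q r : ℚ) : ℚ := -q + p*q*r + r^4 + (-2 : ℚ)*p^2*q*r^2 + 2*p^4*q^2 - p^5*q^2*r

theorem St1y_chart (p q r : ℚ) : fsrc (p*q) q (r*q) = q^4 * St1y p q r := by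
  unfold fsrc St1y; ring

/-- `St1z(x₃,y₃,z)` — (pt) at `P₀`, chart `z`: strict transform misses the new plane here (constant term) (exceptional power 4). -/
def St1z (p q r : ℚ) : ℚ := 1 + (-2 : ℚ)*p^2*q*r + p*q^3*r - q^5*r - p^5*r^2 + 2*p^4*q^2*r^2

theorem St1z_chart (p q r : ℚ) : fsrc (p*r) (q*r) r = r^4 * St1z p q r := by
  unfold fsrc St1z; ring

/-- `G1(X,y,V)` — adapted coordinates `X = x − y₁³`, `V = z₁ − y₁²`: `Z^st = {X = V = 0}`; transversal form `y²X² − 5y³XV + 4y⁴V²`, discriminant `9y⁶`. -/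
def G1 (p q r : ℚ) : ℚ := -p^2*r + r^4 + (-2 : ℚ)*p*q*r^2 + p^2*q^2 + 4*q^2*r^3 + (-5 : ℚ)*p*q^3*r + 4*q^4*r^2

theorem G1_def' (p q r : ℚ) : St1 (p + q^3) q (r + q^2) = G1 p q r := by
  unfold St1 G1; ring

/-- weighted homogeneity, weights `(3, 1, 2)`, degree `8`. -/
theorem G1_weights (t p q r : ℚ) : G1 (t^3*p) (t*q) (t^2*r) = t^8 * G1 p q r := by
  unfold G1; ring

theorem G1_in_IZ_sq (p q r : ℚ) : G1 p q r = p^2*(q^2 - r) + p*r*((-2 : ℚ)*q*r - 5*q^3) + r^2*(r^2 + 4*q^2*r + 4*q^4) := by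
  unfold G1; ring


/-! FREE nose round at `Z^st` (blow-up of `{X = V = 0}`), source side. -/

/-- `TA(X₁,y,V)` — nose round chart A (`X = X₁V`, exceptional `V`): coordinates `(X₁,y,V)`, weights `(1,1,2)`, `E_Z = {V=0}`; `O_A` = origin: `Ẽ₇`-type double point (exceptional power 2). -/
def TA (p q r : ℚ) : ℚ := r^2 + 4*q^2*r + (-2 : ℚ)*p*q*r - p^2*r + 4*q^4 + (-5 : ℚ)*p*q^3 + p^2*q^2

theorem TA_chart (p q r : ℚ) : G1 (p*r) q r = r^2 * TA p q r := by
  unfold G1 TA; ring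

/-- weighted homogeneity, weights `(1, 1, 2)`, degree `4`. -/
theorem TA_weights (t p q r : ℚ) : TA (t*p) (t*q) (t^2*r) = t^4 * TA p q r := by
  unfold TA; ring

theorem TA_trace (p q r : ℚ) : TA p q r = r*(r + 4*q^2 - 2*p*q - p^2) + q^2*(p - q)*(p - 4*q) := by
  unfold TA; ring

theorem TA_square (p q r : ℚ) : TA p q r = (r + (4*q^2 - 2*p*q - p^2)/2)^2 - p*(p^3/4 + p^2*q - 2*p*q^2 + q^3) := by
  unfold TA; ring

/-- `TB(X,y,V₁)` — nose round chart B (`V = V₁X`, exceptional `X`): coordinates `(X,y,V₁)`, `E_Z = {X=0}`; `O_B` = origin: `A₁` (quadratic part `y² − XV₁`) (exceptional power 2). -/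
def TB (p q r : ℚ) : ℚ := q^2 - p*r + (-5 : ℚ)*q^3*r + (-2 : ℚ)*p*q*r^2 + 4*q^4*r^2 + 4*p*q^2*r^3 + p^2*r^4

theorem TB_chart (p q r : ℚ) : G1 p q (r*p) = p^2 * TB p q r := by
  unfold G1 TB; ring

theorem TB_quadratic (p q r : ℚ) : TB p q r = (q^2 - p*r) + (-5*q^3*r - 2*p*q*r^2 + 4*q^4*r^2 + 4*p*q^2*r^3 + p^2*r^4) := by
  unfold TB; ring

/-- `TBx(X,y,V₁)` — (pt-reg) at `O_B`, chart `X`: regular (linear term) (exceptional power 2). -/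
def TBx (p q r : ℚ) : ℚ := -r + q^2 + (-2 : ℚ)*p^2*q*r^2 + (-5 : ℚ)*p^2*q^3*r + p^4*r^4 + 4*p^4*q^2*r^3 + 4*p^4*q^4*r^2

theorem TBx_chart (p q r : ℚ) : TB p (q*p) (r*p) = p^2 * TBx p q r := by
  unfold TB TBx; ring

/-- `TBy(X,y,V₁)` — (pt-reg) at `O_B`, chart `y`: regular (constant term 1) (exceptional power 2). -/
def TBy (p q r : ℚ) : ℚ := 1 - p*r + (-5 : ℚ)*q^2*r + (-2 : ℚ)*p*q^2*r^2 + 4*q^4*r^2 + 4*p*q^4*r^3 + p^2*q^4*r^4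

theorem TBy_chart (p q r : ℚ) : TB (p*q) q (r*q) = q^2 * TBy p q r := by
  unfold TB TBy; ring

/-- `TBv(X,y,V₁)` — (pt-reg) at `O_B`, chart `V₁`: regular (linear term) (exceptional power 2). -/
def TBv (p q r : ℚ) : ℚ := -p + q^2 + (-2 : ℚ)*p*q*r^2 + (-5 : ℚ)*q^3*r^2 + p^2*r^4 + 4*p*q^2*r^4 + 4*q^4*r^4

theorem TBv_chart (p q r : ℚ) : TB (p*r) (q*r) r = r^2 * TBv p q r := by
  unfold TB TBv; ring


/-! Branch `D+`: round R1 at the section `D+` (`sink A₁ = 2s³` ↔ `source X₁ = 4y`), then R2 at the residual section `D′`, then the FIBRE PAIR R3 at `Λ`. -/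

/-- `TAup(u,y,V)` — `u = X₁ − 4y`: `D+ = {V = 0, u = 0}`. -/
def TAup (p q r : ℚ) : ℚ := r^2 + (-20 : ℚ)*q^2*r + (-10 : ℚ)*p*q*r - p^2*r + 3*p*q^3 + p^2*q^2

theorem TAup_def' (p q r : ℚ) : TA (p + 4*q) q r = TAup p q r := by
  unfold TA TAup; ring

/-- `Hp(u,y,V′)` — R1 = round at `D+`, source chart `V = V′u` (exceptional `u`): coordinates `(u,y,V′)`, all weights 1, `E_D = {u=0}`; `p_src` = origin: HOMOGENEOUS CUBIC CONE (`Ẽ₆`; smooth cubic: kit) (exceptional power 1). -/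
def Hp (p q r : ℚ) : ℚ := (-20 : ℚ)*q^2*r + 3*q^3 + p*r^2 + (-10 : ℚ)*p*q*r + p*q^2 - p^2*r

theorem Hp_chart (p q r : ℚ) : TAup p q (r*p) = p^1 * Hp p q r := by
  unfold TAup Hp; ring

/-- weighted homogeneity, weights `(1, 1, 1)`, degree `3`. -/
theorem Hp_weights (t p q r : ℚ) : Hp (t*p) (t*q) (t*r) = t^3 * Hp p q r := by
  unfold Hp; ring

theorem Hp_trace (p q r : ℚ) : Hp 0 q r = q^2*(3*q + (-20 : ℚ)*r) := by
  unfold Hp; ring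

/-- `Hbp(u′,y,V)` — R1 other chart `u = u′V` (exceptional `V`): regular (linear term `V`) (exceptional power 1). -/
def Hbp (p q r : ℚ) : ℚ := r + (-20 : ℚ)*q^2 + (-10 : ℚ)*p*q*r + 3*p*q^3 - p^2*r^2 + p^2*q^2*r

theorem Hbp_chart (p q r : ℚ) : TAup (p*r) q r = r^1 * Hbp p q r := by
  unfold TAup Hbp; ring

/-- `Hvp(u,y,v)` — `v = V′ − (3/20)y`: the residual section `D′ = {u = 0, v = 0}` of `T″ ∩ E_D`. -/
def Hvp (p q r : ℚ) : ℚ := (-20 : ℚ)*q^2*r + p*r^2 + (-97/10 : ℚ)*p*q*r + (-191/400 : ℚ)*p*q^2 - p^2*r + (-3/20 : ℚ)*p^2*q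

theorem Hvp_def' (p q r : ℚ) : Hp p q (r + (3/20 : ℚ)*q) = Hvp p q r := by
  unfold Hp Hvp; ring

/-- `T3p(u,y,v′)` — R2 = round at `D′`, chart `v = v′u` (exceptional `u`): coordinates `(u,y,v′)`, weights `(1,1,0)`, `E_D′ = {u=0}`; SINGULAR ALONG THE FIBRE `Λ = {u = y = 0}` over `p_src` (exceptional power 1). -/
def T3p (p q r : ℚ) : ℚ := (-191/400 : ℚ)*q^2 + (-3/20 : ℚ)*p*q + (-20 : ℚ)*q^2*r + (-97/10 : ℚ)*p*q*r - p^2*r + p^2*r^2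

theorem T3p_chart (p q r : ℚ) : Hvp p q (r*p) = p^1 * T3p p q r := by
  unfold Hvp T3p; ring

theorem T3p_in_Lambda_sq (p q r : ℚ) : T3p p q r = p^2*(-r + r^2) + p*q*((-3/20 : ℚ) + (-97/10 : ℚ)*r) + q^2*((-191/400 : ℚ) + (-20 : ℚ)*r) := by
  unfold T3p; ring

theorem crossing_witness_p (p q r : ℚ) : ((20/3 : ℚ)) * ((r*p + (3/20 : ℚ)*q) - r*p) = q := by
  ring

/-- `T3bp(u′,y,v)` — R2 other chart `u = u′v` (exceptional `v`): `Λ = {v = y = 0}` there (exceptional power 1). -/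
def T3bp (p q r : ℚ) : ℚ := (-20 : ℚ)*q^2 + p*r^2 + (-97/10 : ℚ)*p*q*r + (-191/400 : ℚ)*p*q^2 - p^2*r^2 + (-3/20 : ℚ)*p^2*q*r

theorem T3bp_chart (p q r : ℚ) : Hvp (p*r) q r = r^1 * T3bp p q r := by
  unfold Hvp T3bp; ring

/-- `T4ap(u₁,y,v′)` — R3 = FIBRE PAIR round at `Λ` (`E_D′ ∩ St²E_Z`), subchart `u = u₁y` (exceptional `y`): regular, misses origin (nonzero constant) (exceptional power 2). -/
def T4ap (p q r : ℚ) : ℚ := (-191/400 : ℚ) + (-20 : ℚ)*r + (-3/20 : ℚ)*p + (-97/10 : ℚ)*p*r - p^2*r + p^2*r^2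

theorem T4ap_chart (p q r : ℚ) : T3p (p*q) q r = q^2 * T4ap p q r := by
  unfold T3p T4ap; ring

/-- `T4bp(u,y₁,v′)` — R3 subchart `y = y₁u` (exceptional `u`): regular (linear term `v′`) (exceptional power 2). -/
def T4bp (p q r : ℚ) : ℚ := -r + (-3/20 : ℚ)*q + r^2 + (-97/10 : ℚ)*q*r + (-191/400 : ℚ)*q^2 + (-20 : ℚ)*q^2*r

theorem T4bp_chart (p q r : ℚ) : T3p p (q*p) r = p^2 * T4bp p q r := by
  unfold T3p T4bp; ring

/-- `T4cp(u′,y,v₁)` — R3 from the other R2 chart, subchart `v = v₁y`: regular (nonzero constant) (exceptional power 2). -/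
def T4cp (p q r : ℚ) : ℚ := (-20 : ℚ) + (-191/400 : ℚ)*p + (-97/10 : ℚ)*p*r + p*r^2 + (-3/20 : ℚ)*p^2*r - p^2*r^2

theorem T4cp_chart (p q r : ℚ) : T3bp p q (r*q) = q^2 * T4cp p q r := by
  unfold T3bp T4cp; ring

/-- `T4dp(u′,y₁,v)` — R3 subchart `y = y₁v`: regular (linear term `u′`) (exceptional power 2). -/
def T4dp (p q r : ℚ) : ℚ := p + (-20 : ℚ)*q^2 + (-97/10 : ℚ)*p*q - p^2 + (-191/400 : ℚ)*p*q^2 + (-3/20 : ℚ)*p^2*q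

theorem T4dp_chart (p q r : ℚ) : T3bp p (q*r) r = r^2 * T4dp p q r := by
  unfold T3bp T4dp; ring


/-! Branch `D−`: round R1 at the section `D−` (`sink A₁ = -1s³` ↔ `source X₁ = 1y`), then R2 at the residual section `D′`, then the FIBRE PAIR R3 at `Λ`. -/

/-- `TAum(u,y,V)` — `u = X₁ − 1y`: `D− = {V = 0, u = 0}`. -/
def TAum (p q r : ℚ) : ℚ := r^2 + q^2*r + (-4 : ℚ)*p*q*r - p^2*r + (-3 : ℚ)*p*q^3 + p^2*q^2

theorem TAum_def' (p q r : ℚ) : TA (p + 1*q) q r = TAum p q r := by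
  unfold TA TAum; ring

/-- `Hm(u,y,V′)` — R1 = round at `D−`, source chart `V = V′u` (exceptional `u`): coordinates `(u,y,V′)`, all weights 1, `E_D = {u=0}`; `p_src` = origin: HOMOGENEOUS CUBIC CONE (`Ẽ₆`; smooth cubic: kit) (exceptional power 1). -/
def Hm (p q r : ℚ) : ℚ := q^2*r + (-3 : ℚ)*q^3 + p*r^2 + (-4 : ℚ)*p*q*r + p*q^2 - p^2*r

theorem Hm_chart (p q r : ℚ) : TAum p q (r*p) = p^1 * Hm p q r := by
  unfold TAum Hm; ring

/-- weighted homogeneity, weights `(1, 1, 1)`, degree `3`. -/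
theorem Hm_weights (t p q r : ℚ) : Hm (t*p) (t*q) (t*r) = t^3 * Hm p q r := by
  unfold Hm; ring

theorem Hm_trace (p q r : ℚ) : Hm 0 q r = q^2*((-3 : ℚ)*q + 1*r) := by
  unfold Hm; ring

/-- `Hbm(u′,y,V)` — R1 other chart `u = u′V` (exceptional `V`): regular (linear term `V`) (exceptional power 1). -/
def Hbm (p q r : ℚ) : ℚ := r + q^2 + (-4 : ℚ)*p*q*r + (-3 : ℚ)*p*q^3 - p^2*r^2 + p^2*q^2*r

theorem Hbm_chart (p q r : ℚ) : TAum (p*r) q r = r^1 * Hbm p q r := by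
  unfold TAum Hbm; ring

/-- `Hvm(u,y,v)` — `v = V′ − (3)y`: the residual section `D′ = {u = 0, v = 0}` of `T″ ∩ E_D`. -/
def Hvm (p q r : ℚ) : ℚ := q^2*r + p*r^2 + 2*p*q*r + (-2 : ℚ)*p*q^2 - p^2*r + (-3 : ℚ)*p^2*q

theorem Hvm_def' (p q r : ℚ) : Hm p q (r + 3*q) = Hvm p q r := by
  unfold Hm Hvm; ring

/-- `T3m(u,y,v′)` — R2 = round at `D′`, chart `v = v′u` (exceptional `u`): coordinates `(u,y,v′)`, weights `(1,1,0)`, `E_D′ = {u=0}`; SINGULAR ALONG THE FIBRE `Λ = {u = y = 0}` over `p_src` (exceptional power 1). -/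
def T3m (p q r : ℚ) : ℚ := (-2 : ℚ)*q^2 + (-3 : ℚ)*p*q + q^2*r + 2*p*q*r - p^2*r + p^2*r^2

theorem T3m_chart (p q r : ℚ) : Hvm p q (r*p) = p^1 * T3m p q r := by
  unfold Hvm T3m; ring

theorem T3m_in_Lambda_sq (p q r : ℚ) : T3m p q r = p^2*(-r + r^2) + p*q*((-3 : ℚ) + 2*r) + q^2*((-2 : ℚ) + r) := by
  unfold T3m; ring

theorem crossing_witness_m (p q r : ℚ) : ((1/3 : ℚ)) * ((r*p + 3*q) - r*p) = q := by
  ring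

/-- `T3bm(u′,y,v)` — R2 other chart `u = u′v` (exceptional `v`): `Λ = {v = y = 0}` there (exceptional power 1). -/
def T3bm (p q r : ℚ) : ℚ := q^2 + p*r^2 + 2*p*q*r + (-2 : ℚ)*p*q^2 - p^2*r^2 + (-3 : ℚ)*p^2*q*r

theorem T3bm_chart (p q r : ℚ) : Hvm (p*r) q r = r^1 * T3bm p q r := by
  unfold Hvm T3bm; ring

/-- `T4am(u₁,y,v′)` — R3 = FIBRE PAIR round at `Λ` (`E_D′ ∩ St²E_Z`), subchart `u = u₁y` (exceptional `y`): regular, misses origin (nonzero constant) (exceptional power 2). -/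
def T4am (p q r : ℚ) : ℚ := (-2 : ℚ) + r + (-3 : ℚ)*p + 2*p*r - p^2*r + p^2*r^2

theorem T4am_chart (p q r : ℚ) : T3m (p*q) q r = q^2 * T4am p q r := by
  unfold T3m T4am; ring

/-- `T4bm(u,y₁,v′)` — R3 subchart `y = y₁u` (exceptional `u`): regular (linear term `v′`) (exceptional power 2). -/
def T4bm (p q r : ℚ) : ℚ := -r + (-3 : ℚ)*q + r^2 + 2*q*r + (-2 : ℚ)*q^2 + q^2*r

theorem T4bm_chart (p q r : ℚ) : T3m p (q*p) r = p^2 * T4bm p q r := by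
  unfold T3m T4bm; ring

/-- `T4cm(u′,y,v₁)` — R3 from the other R2 chart, subchart `v = v₁y`: regular (nonzero constant) (exceptional power 2). -/
def T4cm (p q r : ℚ) : ℚ := 1 + (-2 : ℚ)*p + 2*p*r + p*r^2 + (-3 : ℚ)*p^2*r - p^2*r^2

theorem T4cm_chart (p q r : ℚ) : T3bm p q (r*q) = q^2 * T4cm p q r := by
  unfold T3bm T4cm; ring

/-- `T4dm(u′,y₁,v)` — R3 subchart `y = y₁v`: regular (linear term `u′`) (exceptional power 2). -/
def T4dm (p q r : ℚ) : ℚ := p + q^2 + 2*p*q - p^2 + (-2 : ℚ)*p*q^2 + (-3 : ℚ)*p^2*q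

theorem T4dm_chart (p q r : ℚ) : T3bm p (q*r) r = r^2 * T4dm p q r := by
  unfold T3bm T4dm; ring


/-! §2 SINK POLE `e_z = [0:0:1:0]` (chart `z = 1`; coordinates `A = w − x²y`, `C = y² − x`, `s = y`; coordinate weights `(−5,−2,−1)`, written below with the opposite sign convention `(5,2,1)`). -/

/-- `Fsnk(A,C,s)` — `F(s² − C, s, 1, A + (s² − C)²s)`: `Z = {A = C = 0}`, `e_z` = origin, multiplicity 2; transversal form `A² − s³AC − 2s⁶C²·(unit)`, discriminant `9s⁶·(unit)`. -/
def Fsnk (p q r : ℚ) : ℚ := p^2 + q^5 - p*q*r^3 + (-4 : ℚ)*q^4*r^2 + 5*q^3*r^4 + (-2 : ℚ)*q^2*r^6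

theorem Fsnk_eq_F (p q r : ℚ) : Fsnk p q r = F (r^2 - q) r 1 (p + (r^2 - q)^2*r) := by
  unfold Fsnk F; ring

/-- weighted homogeneity, weights `(5, 2, 1)`, degree `10`. -/
theorem Fsnk_weights (t p q r : ℚ) : Fsnk (t^5*p) (t^2*q) (t*r) = t^10 * Fsnk p q r := by
  unfold Fsnk; ring

/-- `Fsnk1(A′,C′,s)` — THE OPENING `b = 1` (not used by the word W): (pt) at `e_z`, chart `s` (`A = A′s, C = C′s`): singular along `Z^st = {A′=C′=0}` AND along the extra line `L′ = {A′ = s = 0}` of the new plane (kit C0.b=1); memo §4 (exceptional power 2). -/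
def Fsnk1 (p q r : ℚ) : ℚ := p^2 - p*q*r^3 + (-2 : ℚ)*q^2*r^6 + 5*q^3*r^5 + (-4 : ℚ)*q^4*r^4 + q^5*r^3

theorem Fsnk1_chart (p q r : ℚ) : Fsnk (p*r) (q*r) r = r^2 * Fsnk1 p q r := by
  unfold Fsnk Fsnk1; ring

theorem Fsnk1_in_Lprime_sq (p q r : ℚ) : Fsnk1 p q r = p^2 + r*(-(p*q*r^2) - 2*q^2*r^5 + 5*q^3*r^4 - 4*q^4*r^3 + q^5*r^2) := by
  unfold Fsnk1; ring


/-! FREE nose round at `Z^st`, sink side (`b = 0`). -/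

/-- `G(A₁,C,s)` — nose round chart `A = A₁C` (exceptional `C`): coordinates `(A₁,C,s)`, weights `(3,2,1)`, `E_Z = {C = 0}`; `q₀` = origin: `Ẽ₈`-type double point `u² + h(C,s²)` (exceptional power 2). -/
def G (p q r : ℚ) : ℚ := p^2 + q^3 + (-4 : ℚ)*q^2*r^2 - p*r^3 + 5*q*r^4 + (-2 : ℚ)*r^6

theorem G_chart (p q r : ℚ) : Fsnk (p*q) q r = q^2 * G p q r := by
  unfold Fsnk G; ring

/-- weighted homogeneity, weights `(3, 2, 1)`, degree `6`. -/
theorem G_weights (t p q r : ℚ) : G (t^3*p) (t^2*q) (t*r) = t^6 * G p q r := by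
  unfold G; ring

theorem G_trace_factor (p q r : ℚ) : G p q r = q*(q^2 - 4*q*r^2 + 5*r^4) + (p - 2*r^3)*(p + r^3) := by
  unfold G; ring

theorem G_square (p q r : ℚ) : G p q r = (p - r^3/2)^2 + (q^3 - 4*q^2*r^2 + 5*q*r^4 - (9/4 : ℚ)*r^6) := by
  unfold G; ring

/-- `Gb(A,C₁,s)` — nose round other chart `C = C₁A` (exceptional `A`): regular, misses `E_Z ∩` origin (constant term 1) (exceptional power 2). -/
def Gb (p q r : ℚ) : ℚ := 1 - q*r^3 + (-2 : ℚ)*q^2*r^6 + 5*p*q^3*r^4 + (-4 : ℚ)*p^2*q^4*r^2 + p^3*q^5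

theorem Gb_chart (p q r : ℚ) : Fsnk p (q*p) r = p^2 * Gb p q r := by
  unfold Fsnk Gb; ring


/-! Branch `D+` at the sink: `u = A₁ − (2)s³`. -/

/-- `Gup(u,C,s)` — `u = A₁ − (2)s³`: `D+ = {C = 0, u = 0}`. -/
def Gup (p q r : ℚ) : ℚ := p^2 + q^3 + (-4 : ℚ)*q^2*r^2 + 3*p*r^3 + 5*q*r^4

theorem Gup_def' (p q r : ℚ) : G (p + 2*r^3) q r = Gup p q r := by
  unfold G Gup; ring

/-- `S2p(u′,C,s)` — R1 = round at `D+`, sink chart `u = u′C` (exceptional `C`): coordinates `(u′,C,s)`, weights `(1,2,1)`, `E_D = {C=0}`; `q₁` = origin: `Ẽ₇`-type double point (exceptional power 1). -/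
def S2p (p q r : ℚ) : ℚ := q^2 + (-4 : ℚ)*q*r^2 + p^2*q + 5*r^4 + 3*p*r^3

theorem S2p_chart (p q r : ℚ) : Gup (p*q) q r = q^1 * S2p p q r := by
  unfold Gup S2p; ring

/-- weighted homogeneity, weights `(1, 2, 1)`, degree `4`. -/
theorem S2p_weights (t p q r : ℚ) : S2p (t*p) (t^2*q) (t*r) = t^4 * S2p p q r := by
  unfold S2p; ring

theorem S2p_square (p q r : ℚ) : S2p p q r = (q - 2*r^2 + p^2/2)^2 - (p^4/4 - 2*p^2*r^2 - 3*p*r^3 - r^4) := by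
  unfold S2p; ring

theorem S2p_trace (p q r : ℚ) : S2p p 0 r = r^3*(5*r + 3*p) := by
  unfold S2p; ring

/-- `S2bp(u,C′,s)` — R1 other chart `C = C′u` (exceptional `u`): regular (linear term `u`); `St E_Z = {C′ = 0}` lives here, so `q₁ ∉ St E_Z` (exceptional power 1). -/
def S2bp (p q r : ℚ) : ℚ := p + 3*r^3 + 5*q*r^4 + (-4 : ℚ)*p*q^2*r^2 + p^2*q^3

theorem S2bp_chart (p q r : ℚ) : Gup p (q*p) r = p^1 * S2bp p q r := by
  unfold Gup S2bp; ring

/-- `S2sp(u″,C,s)` — `u″ = u′ − (-5/3)s`: the residual section `D′ = {C = 0, u″ = 0}` of `T″ ∩ E_D`. -/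
def S2sp (p q r : ℚ) : ℚ := q^2 + (-11/9 : ℚ)*q*r^2 + (-10/3 : ℚ)*p*q*r + p^2*q + 3*p*r^3

theorem S2sp_def' (p q r : ℚ) : S2p (p + (-5/3 : ℚ)*r) q r = S2sp p q r := by
  unfold S2p S2sp; ring

/-- `S3p(u″,C′,s)` — R2 = round at `D′`, sink chart `C = C′u″` (exceptional `u″`): coordinates `(u″,C′,s)`, all weights 1; `q₂` = origin: HOMOGENEOUS CUBIC CONE (`Ẽ₆`; smooth cubic: kit) (exceptional power 1). -/
def S3p (p q r : ℚ) : ℚ := 3*r^3 + (-11/9 : ℚ)*q*r^2 + (-10/3 : ℚ)*p*q*r + p*q^2 + p^2*q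

theorem S3p_chart (p q r : ℚ) : S2sp p (q*p) r = p^1 * S3p p q r := by
  unfold S2sp S3p; ring

/-- weighted homogeneity, weights `(1, 1, 1)`, degree `3`. -/
theorem S3p_weights (t p q r : ℚ) : S3p (t*p) (t*q) (t*r) = t^3 * S3p p q r := by
  unfold S3p; ring

/-- `S3bp(u‴,C,s)` — R2 other chart `u″ = u‴C` (exceptional `C`): regular (linear term `C`) (exceptional power 1). -/
def S3bp (p q r : ℚ) : ℚ := q + (-11/9 : ℚ)*r^2 + (-10/3 : ℚ)*p*q*r + 3*p*r^3 + p^2*q^2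

theorem S3bp_chart (p q r : ℚ) : S2sp (p*q) q r = q^1 * S3bp p q r := by
  unfold S2sp S3bp; ring

/-- `S4ap(u″,C′,s)` — (pt-reg) at `q₂`, chart `u″`: regular (linear term `C′`) (exceptional power 3). -/
def S4ap (p q r : ℚ) : ℚ := q + (-10/3 : ℚ)*q*r + q^2 + 3*r^3 + (-11/9 : ℚ)*q*r^2

theorem S4ap_chart (p q r : ℚ) : S3p p (q*p) (r*p) = p^3 * S4ap p q r := by
  unfold S3p S4ap; ring

/-- `S4bp(u″,C′,s)` — (pt-reg) at `q₂`, chart `C′`: regular (linear term `u″`) (exceptional power 3). -/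
def S4bp (p q r : ℚ) : ℚ := p + (-11/9 : ℚ)*r^2 + (-10/3 : ℚ)*p*r + p^2 + 3*r^3

theorem S4bp_chart (p q r : ℚ) : S3p (p*q) q (r*q) = q^3 * S4bp p q r := by
  unfold S3p S4bp; ring

/-- `S4cp(u″,C′,s)` — (pt-reg) at `q₂`, chart `s`: regular (nonzero constant) (exceptional power 3). -/
def S4cp (p q r : ℚ) : ℚ := 3 + (-11/9 : ℚ)*q + (-10/3 : ℚ)*p*q + p*q^2 + p^2*q

theorem S4cp_chart (p q r : ℚ) : S3p (p*r) (q*r) r = r^3 * S4cp p q r := by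
  unfold S3p S4cp; ring


/-! Branch `D−` at the sink: `u = A₁ − (-1)s³`. -/

/-- `Gum(u,C,s)` — `u = A₁ − (-1)s³`: `D− = {C = 0, u = 0}`. -/
def Gum (p q r : ℚ) : ℚ := p^2 + q^3 + (-4 : ℚ)*q^2*r^2 + (-3 : ℚ)*p*r^3 + 5*q*r^4

theorem Gum_def' (p q r : ℚ) : G (p + (-1 : ℚ)*r^3) q r = Gum p q r := by
  unfold G Gum; ring

/-- `S2m(u′,C,s)` — R1 = round at `D−`, sink chart `u = u′C` (exceptional `C`): coordinates `(u′,C,s)`, weights `(1,2,1)`, `E_D = {C=0}`; `q₁` = origin: `Ẽ₇`-type double point (exceptional power 1). -/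
def S2m (p q r : ℚ) : ℚ := q^2 + (-4 : ℚ)*q*r^2 + p^2*q + 5*r^4 + (-3 : ℚ)*p*r^3

theorem S2m_chart (p q r : ℚ) : Gum (p*q) q r = q^1 * S2m p q r := by
  unfold Gum S2m; ring

/-- weighted homogeneity, weights `(1, 2, 1)`, degree `4`. -/
theorem S2m_weights (t p q r : ℚ) : S2m (t*p) (t^2*q) (t*r) = t^4 * S2m p q r := by
  unfold S2m; ring

theorem S2m_square (p q r : ℚ) : S2m p q r = (q - 2*r^2 + p^2/2)^2 - (p^4/4 - 2*p^2*r^2 - (-3 : ℚ)*p*r^3 - r^4) := by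
  unfold S2m; ring

theorem S2m_trace (p q r : ℚ) : S2m p 0 r = r^3*(5*r + (-3 : ℚ)*p) := by
  unfold S2m; ring

/-- `S2bm(u,C′,s)` — R1 other chart `C = C′u` (exceptional `u`): regular (linear term `u`); `St E_Z = {C′ = 0}` lives here, so `q₁ ∉ St E_Z` (exceptional power 1). -/
def S2bm (p q r : ℚ) : ℚ := p + (-3 : ℚ)*r^3 + 5*q*r^4 + (-4 : ℚ)*p*q^2*r^2 + p^2*q^3

theorem S2bm_chart (p q r : ℚ) : Gum p (q*p) r = p^1 * S2bm p q r := by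
  unfold Gum S2bm; ring

/-- `S2sm(u″,C,s)` — `u″ = u′ − (5/3)s`: the residual section `D′ = {C = 0, u″ = 0}` of `T″ ∩ E_D`. -/
def S2sm (p q r : ℚ) : ℚ := q^2 + (-11/9 : ℚ)*q*r^2 + (10/3 : ℚ)*p*q*r + p^2*q + (-3 : ℚ)*p*r^3

theorem S2sm_def' (p q r : ℚ) : S2m (p + (5/3 : ℚ)*r) q r = S2sm p q r := by
  unfold S2m S2sm; ring

/-- `S3m(u″,C′,s)` — R2 = round at `D′`, sink chart `C = C′u″` (exceptional `u″`): coordinates `(u″,C′,s)`, all weights 1; `q₂` = origin: HOMOGENEOUS CUBIC CONE (`Ẽ₆`; smooth cubic: kit) (exceptional power 1). -/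
def S3m (p q r : ℚ) : ℚ := (-3 : ℚ)*r^3 + (-11/9 : ℚ)*q*r^2 + (10/3 : ℚ)*p*q*r + p*q^2 + p^2*q

theorem S3m_chart (p q r : ℚ) : S2sm p (q*p) r = p^1 * S3m p q r := by
  unfold S2sm S3m; ring

/-- weighted homogeneity, weights `(1, 1, 1)`, degree `3`. -/
theorem S3m_weights (t p q r : ℚ) : S3m (t*p) (t*q) (t*r) = t^3 * S3m p q r := by
  unfold S3m; ring

/-- `S3bm(u‴,C,s)` — R2 other chart `u″ = u‴C` (exceptional `C`): regular (linear term `C`) (exceptional power 1). -/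
def S3bm (p q r : ℚ) : ℚ := q + (-11/9 : ℚ)*r^2 + (10/3 : ℚ)*p*q*r + (-3 : ℚ)*p*r^3 + p^2*q^2

theorem S3bm_chart (p q r : ℚ) : S2sm (p*q) q r = q^1 * S3bm p q r := by
  unfold S2sm S3bm; ring

/-- `S4am(u″,C′,s)` — (pt-reg) at `q₂`, chart `u″`: regular (linear term `C′`) (exceptional power 3). -/
def S4am (p q r : ℚ) : ℚ := q + (10/3 : ℚ)*q*r + q^2 + (-3 : ℚ)*r^3 + (-11/9 : ℚ)*q*r^2

theorem S4am_chart (p q r : ℚ) : S3m p (q*p) (r*p) = p^3 * S4am p q r := by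
  unfold S3m S4am; ring

/-- `S4bm(u″,C′,s)` — (pt-reg) at `q₂`, chart `C′`: regular (linear term `u″`) (exceptional power 3). -/
def S4bm (p q r : ℚ) : ℚ := p + (-11/9 : ℚ)*r^2 + (10/3 : ℚ)*p*r + p^2 + (-3 : ℚ)*r^3

theorem S4bm_chart (p q r : ℚ) : S3m (p*q) q (r*q) = q^3 * S4bm p q r := by
  unfold S3m S4bm; ring

/-- `S4cm(u″,C′,s)` — (pt-reg) at `q₂`, chart `s`: regular (nonzero constant) (exceptional power 3). -/
def S4cm (p q r : ℚ) : ℚ := (-3 : ℚ) + (-11/9 : ℚ)*q + (10/3 : ℚ)*p*q + p*q^2 + p^2*q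

theorem S4cm_chart (p q r : ℚ) : S3m (p*r) (q*r) r = r^3 * S4cm p q r := by
  unfold S3m S4cm; ring


/-! §3 Self-intersection inputs (𝔾ₘ-localisation on a `𝔾ₘ`-curve `Γ ≅ ℙ¹` with fixed ends `0`, `∞`:
`deg L = (w_∞ − w₀)/c₀` for an equivariant line bundle with local generating sections of weights `w₀`, `w_∞` and tangent-coordinate weight `c₀` at `0`;
calibration: the exceptional curve of `Bl₀𝔸²` under `(tu, c)` gives `deg N^∨ = 1`). Conormal generators: `D`: source `X₁ − 4y` (wt 1), sink `A₁ − 2s³` (wt −3)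
⇒ `deg N^∨_{D/E_Z} = −4`, `D² = 4 ≥ −1`; `D′`: source `V′ − (3/20)y` (wt 1), sink `u′ + (5/3)s` (wt −1) ⇒ `D′² = 2 ≥ −1` (memo §3; `DirStepUnobs` for R1, R2). -/

/-- the localisation formula used in memo §3. -/
def degLoc (w0 winf c0 : ℚ) : ℚ := (winf - w0) / c0

example : degLoc 0 1 1 = 1 := by norm_num [degLoc]            -- calibration: `E² = −1` on `Bl₀𝔸²`
example : degLoc 1 (-3) 1 = -4 := by norm_num [degLoc]        -- `deg N^∨_{D/E_Z} = −4`, i.e. `D² = 4`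
example : degLoc 1 (-1) 1 = -2 := by norm_num [degLoc]        -- `deg N^∨_{D′/E_D} = −2`, i.e. `D′² = 2`
example : degLoc 3 (-5) 1 = -8 ∧ degLoc 2 (-2) 1 = -4 := by norm_num [degLoc]   -- `N^∨_{Z^st}` ≅ `O(−8) ⊕ O(−4)` (lead-1 SIGMA6-WALK §3: `N ≅ O(8)⊕O(4)`)

end Summit.ResolutionOfSingularities.ResolutionOfSingularities.Cruxes.EquisingularLiftNatThree.GmNosesBlobR27
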